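import Summits.Ventures.CertifiedManyBodySolver.Observables.StiffnessApexTransportCurtainTopLaBoxE
import HarnessLib

/-!
# Ventures/CertifiedManyBodySolver — Observables/StiffnessApexTransportCurtainTopShadow.lean

HONEST FRAMING: one-sided certified CEILINGS on the uniform flux stiffness (`t–t′` f-sum class) at half filling, transported into the part of a `(t′, U)` box that
lies LEFT of the station's apex curve (the «TransportFan» shadow); a ceiling never speaks to the presence of order; not a `T_c` estimate, not a superconductivity
verdict; every leaf is CONDITIONAL on the row families it names. Zero compute, no definition, no claim node, no `sorry`.

Cell `pub/hubbard-downfold` (D-0154 (1)(C) COVERAGE, La214 M2(b) depth «74/5 insurance»), seat `hubbard-cov-la214-unc-2` (`prover-hubbard-cov-la214-unc-2-0`); companion of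
`Observables/StiffnessApexTransportCurtainTop.lean` (this seat: two-window curtain master, edition (E6), chord form). WHY: the route pen of «CovLa214M2b»
(hubbard-m2-certneg-1, obs STATUS 2026-08-28T06:01:22Z) splits the La214-E rung leaf into the two APEX-FAN SHADOWS of the station `U_A = 29/5` — K1 «SegmentFanCeiling»
(targets whose station source `s = t′(2 − U_A/U)` lies in `[p, q]`) and K2 «TransportFanCeiling» (targets with `s ≤ p`, worded «by the corner-objective overhang bundle E1 OR the
left-edge U-bundle E2 OR point fans»). This file types the K2 shadow of the TWO-WINDOW curtain and of (E6): the targets with `s ≤ p` need NO inner family — the lower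
left-edge window, the short overhang and the upper left-edge window alone word them.

* `ObsStiffnessSeqCeilingAt_halfFilling_transportShadow_of_twoWindowCurtain` — LEFT₁ `{p} × [U_A, U_L₁]` + OVERHANG at `U_L₁` on `[p(2 − U_L₁/U_L₂), p]` + LEFT₂
  `{p} × [U_L₂, U_max]` ⇒ `ObsStiffnessSeqCeilingAt t′ U 1 c` at every box target with `t′(2U − U_A)/U ≤ p`;
* `ObsStiffnessSeqCeilingAt_halfFilling_transportShadow_of_shortOverhang_and_leftEdgeTop` — (E6)'s shadow: SHORT overhang `[p(2 − U_A/U_L), p] × {U_A}` + LEFT-TOP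
  `{p} × [U_L, U_max]` ⇒ the same;
* «La214-E» instances: any window height `U_L ≥ 29/5`, and `U_L = 8` (overhang `[−153/400, −3/10] × {29/5}` + left-top `{−3/10} × [8, 74/5]` ⇒ every target of
  `[−3/10, −1/5] × [29/5, 74/5]` with `t′(2U − 29/5)/U ≤ −3/10`).

References: T. Koma, H. Tasaki, J. Stat. Phys. 76 (1994) 745, §1 [KomaTasaki1994]; D. J. Scalapino, S. R. White, S.-C. Zhang, PRB 47 (1993)
7995, §II [ScalapinoWhiteZhang1993].
-/

noncomputable section

namespace Summit.Ventures.CertifiedManyBodySolver.Observables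

open Literature.MathematicalPhysics.QuantumLattice
open Literature.MathematicalPhysics.QuantumLattice.ThermodynamicLimit
open Literature.MathematicalPhysics.QuantumFieldTheory
open Literature.Probability.LatticeModels
open Matrix Finset Filter Topology HubbardWave0
open scoped Matrix BigOperators ComplexOrder

section Shadow

variable {UA UL₁ UL₂ Umax p q : ℝ}

/-- **Transport-fan shadow of the two-window curtain (half filling).** Box `[p, q] × [U_A, U_max]`, `q ≤ 0 < U_A ≤ U_L₁ ≤ U_L₂`. WITHOUT any bottom (inner) family:
the LEFT₁ own-word family on `{p} × [U_A, U_L₁]`, the corner-objective (`−X₀(p)`) OVERHANG family at the height `U_L₁` on `[p(2 − U_L₁/U_L₂), p]`, and the LEFT₂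
own-word family on `{p} × [U_L₂, U_max]`, all with `−val ≤ c`, give `ObsStiffnessSeqCeilingAt t′ U 1 c` at every box target whose source parameter at the station
`U_A` does not enter the box, `t′(2U − U_A)/U ≤ p` (every target on or LEFT of the apex curve of the corner `(p, U_A)`). The apex segment of such a target crosses
`t′ = p` at `U' = U(2 − p/t′) ≥ U_A`: in the lower window ⇒ LEFT₁; in the upper ⇒ LEFT₂; strictly between ⇒ it passes the height `U_L₁` inside the short overhang
(slab estimate below `U_L₂`, §1 of the companion contraposed above); at equality the source is the corner `(p, U_A)` (LEFT₁ at `U_A`).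
[cite: KomaTasaki1994, §1] [cite: ScalapinoWhiteZhang1993, §II] -/
theorem ObsStiffnessSeqCeilingAt_halfFilling_transportShadow_of_twoWindowCurtain (hUA : 0 < UA) (hA1 : UA ≤ UL₁) (h12 : UL₁ ≤ UL₂)
    (hq : q ≤ 0) (valL₁ valO valL₂ : ℝ → ℝ) (c : ℚ)
    (hL₁ : ∀ U' ∈ Set.Icc UA UL₁,
      ∀ (ω : InfVolFermionState 2) (Ls : ℕ → ℕ) (ψ : ∀ L, Fock (Orb (FermionTorus 2 L))),
      Tendsto Ls atTop atTop →
      (∀ j, IsGroundStateInSector (hubbardTorusTT' (Ls j) 1 p U') (rectN 1 (Ls j)) 0 (ψ (Ls j))) →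
      (∀ j, star (ψ (Ls j)) ⬝ᵥ ψ (Ls j) = 1) → ω.IsTorusLimitOf ψ Ls →
      valL₁ U' ≤ ((Finset.univ : Finset (DihedralGroup 4)).card : ℝ)⁻¹ * ∑ g ∈ (Finset.univ : Finset (DihedralGroup 4)),
        (ω.expect (d4ShiftSet g 0 (box 2 7)) (fermionEmbed (PolySite.d4Emb g 0 (box 2 7)) (-oddMomentObsTT p U' 0))).re)
    (hcL₁ : ∀ U' ∈ Set.Icc UA UL₁, -valL₁ U' ≤ ((c : ℚ) : ℝ))
    (hO : ∀ s ∈ Set.Icc (p * (2 - UL₁ / UL₂)) p,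
      ∀ (ω : InfVolFermionState 2) (Ls : ℕ → ℕ) (ψ : ∀ L, Fock (Orb (FermionTorus 2 L))),
      Tendsto Ls atTop atTop →
      (∀ j, IsGroundStateInSector (hubbardTorusTT' (Ls j) 1 s UL₁) (rectN 1 (Ls j)) 0 (ψ (Ls j))) →
      (∀ j, star (ψ (Ls j)) ⬝ᵥ ψ (Ls j) = 1) → ω.IsTorusLimitOf ψ Ls →
      valO s ≤ ((Finset.univ : Finset (DihedralGroup 4)).card : ℝ)⁻¹ * ∑ g ∈ (Finset.univ : Finset (DihedralGroup 4)),
        (ω.expect (d4ShiftSet g 0 (box 2 7)) (fermionEmbed (PolySite.d4Emb g 0 (box 2 7)) (-oddMomentObsTT p UL₁ 0))).re)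
    (hcO : ∀ s ∈ Set.Icc (p * (2 - UL₁ / UL₂)) p, -valO s ≤ ((c : ℚ) : ℝ))
    (hL₂ : ∀ U' ∈ Set.Icc UL₂ Umax,
      ∀ (ω : InfVolFermionState 2) (Ls : ℕ → ℕ) (ψ : ∀ L, Fock (Orb (FermionTorus 2 L))),
      Tendsto Ls atTop atTop →
      (∀ j, IsGroundStateInSector (hubbardTorusTT' (Ls j) 1 p U') (rectN 1 (Ls j)) 0 (ψ (Ls j))) →
      (∀ j, star (ψ (Ls j)) ⬝ᵥ ψ (Ls j) = 1) → ω.IsTorusLimitOf ψ Ls →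
      valL₂ U' ≤ ((Finset.univ : Finset (DihedralGroup 4)).card : ℝ)⁻¹ * ∑ g ∈ (Finset.univ : Finset (DihedralGroup 4)),
        (ω.expect (d4ShiftSet g 0 (box 2 7)) (fermionEmbed (PolySite.d4Emb g 0 (box 2 7)) (-oddMomentObsTT p U' 0))).re)
    (hcL₂ : ∀ U' ∈ Set.Icc UL₂ Umax, -valL₂ U' ≤ ((c : ℚ) : ℝ)) :
    ∀ tp ∈ Set.Icc p q, ∀ U ∈ Set.Icc UA Umax, tp * (2 * U - UA) / U ≤ p → ObsStiffnessSeqCeilingAt tp U 1 c := by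
  intro tp htp U hU hsA
  have hUP : 0 < U := hUA.trans_le hU.1
  have hUne : U ≠ 0 := hUP.ne'
  rcases hsA.lt_or_eq with hsA | hsA
  · -- the station source overhangs: `t′ < 0`, `p < 0`; the segment crosses `t′ = p` at `U' = U(2 − p/t′) > U_A`
    have ht0 : tp < 0 := by
      rcases (htp.2.trans hq).eq_or_lt with h0 | h0
      · exfalso
        rw [h0, zero_mul, zero_div] at hsA
        exact absurd (htp.1.trans_eq h0) (not_le.2 hsA)
      · exact h0
    have hp0 : p < 0 := lt_of_le_of_lt htp.1 ht0
    obtain ⟨hU'le, hapexL⟩ := leftEdge_apexSource htp.1 ht0 hUP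
    have hU'gt : UA < U * (2 - p / tp) := (apexSource_lt_iff_station_lt_leftEdge ht0 hUP).1 hsA
    have hk : 0 ≤ 2 * (p - tp) / p := div_nonneg_of_nonpos (by linarith [htp.1]) hp0.le
    have hslot : 2 * p - 2 * tp = 2 * (p - tp) / p * p := by
      rw [div_mul_cancel₀ _ hp0.ne]; ring
    by_cases h1 : U * (2 - p / tp) ≤ UL₁
    · -- (LEFT₁)
      have hmem : U * (2 - p / tp) ∈ Set.Icc UA UL₁ := ⟨hU'gt.le, h1⟩
      exact ObsStiffnessSeqCeilingAt_halfFilling_of_apexSource_orbitLower_slot p (U * (2 - p / tp)) (valL₁ (U * (2 - p / tp)))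
        (hUA.le.trans hU'gt.le) hU'le hUP hapexL (hL₁ _ hmem) hk hslot c (hcL₁ _ hmem)
    · have h1 : UL₁ < U * (2 - p / tp) := not_le.mp h1
      by_cases h2 : UL₂ ≤ U * (2 - p / tp)
      · -- (LEFT₂)
        have hmem : U * (2 - p / tp) ∈ Set.Icc UL₂ Umax := ⟨h2, hU'le.trans hU.2⟩
        exact ObsStiffnessSeqCeilingAt_halfFilling_of_apexSource_orbitLower_slot p (U * (2 - p / tp)) (valL₂ (U * (2 - p / tp)))
          (hUA.le.trans hU'gt.le) hU'le hUP hapexL (hL₂ _ hmem) hk hslot c (hcL₂ _ hmem)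
      · -- (OVERHANG at `U_L₁`): `s₁ = t′(2U − U_L₁)/U ∈ [p(2 − U_L₁/U_L₂), p)`
        have h2 : U * (2 - p / tp) < UL₂ := not_le.mp h2
        have hL1pos : 0 < UL₁ := hUA.trans_le hA1
        have hL1U : UL₁ ≤ U := h1.le.trans hU'le
        have hs1lt : tp * (2 * U - UL₁) / U < p := (apexSource_lt_iff_station_lt_leftEdge ht0 hUP).2 h1
        have hs1ge : p * (2 - UL₁ / UL₂) ≤ tp * (2 * U - UL₁) / U := by
          rcases le_or_gt U UL₂ with hU2 | hU2
          · exact (apexSource_mem_Icc_of_slab (p := p) (UA := UL₁) (Umax := UL₂) hL1pos hL1U hU2 hq htp).1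
          · by_contra hcon
            have hlt := leftEdge_height_gt_of_apexSource_lt_shortOverhang (p := p) ht0 hL1pos h12 hU2.le (not_le.mp hcon)
            exact absurd h2 (not_lt.2 hlt.le)
        have hmem : tp * (2 * U - UL₁) / U ∈ Set.Icc (p * (2 - UL₁ / UL₂)) p := ⟨hs1ge, hs1lt.le⟩
        have hs0 : tp * (2 * U - UL₁) / U < 0 := hs1lt.trans hp0
        have hk' : 0 ≤ 2 * (p - tp) / (tp * (2 * U - UL₁) / U) := div_nonneg_of_nonpos (by linarith [htp.1]) hs0.le
        have hslot' : 2 * p - 2 * tp = 2 * (p - tp) / (tp * (2 * U - UL₁) / U) * (tp * (2 * U - UL₁) / U) := by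
          rw [div_mul_cancel₀ _ hs0.ne]; ring
        have hapexO : U * (tp * (2 * U - UL₁) / U) = (2 * U - UL₁) * tp := by
          rw [mul_div_assoc', mul_div_cancel_left₀ _ hUne]; ring
        exact ObsStiffnessSeqCeilingAt_halfFilling_of_apexSource_orbitLower_slot p UL₁ (valO (tp * (2 * U - UL₁) / U)) hL1pos.le
          hL1U hUP hapexO (hO _ hmem) hk' hslot' c (hcO _ hmem)
  · -- equality: the source IS the corner `(p, U_A)` — LEFT₁ at `U' = U_A`, slot `p`
    have hapex : U * p = (2 * U - UA) * tp := by
      have e : tp * (2 * U - UA) = p * U := (div_eq_iff hUne).1 hsA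
      linarith [e]
    have hp0 : p ≤ 0 := htp.1.trans (htp.2.trans hq)
    rcases hp0.lt_or_eq with hp0 | hp0
    · have hk : 0 ≤ 2 * (p - tp) / p := div_nonneg_of_nonpos (by linarith [htp.1]) hp0.le
      have hslot : 2 * p - 2 * tp = 2 * (p - tp) / p * p := by
        rw [div_mul_cancel₀ _ hp0.ne]; ring
      exact ObsStiffnessSeqCeilingAt_halfFilling_of_apexSource_orbitLower_slot p UA (valL₁ UA) hUA.le hU.1 hUP hapex
        (hL₁ UA ⟨le_rfl, hA1⟩) hk hslot c (hcL₁ UA ⟨le_rfl, hA1⟩)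
    · -- `p = 0` forces `t′ = 0`: slot condition with `k = 0`
      have htp0 : tp = 0 := le_antisymm (htp.2.trans hq) (hp0 ▸ htp.1)
      exact ObsStiffnessSeqCeilingAt_halfFilling_of_apexSource_orbitLower_slot p UA (valL₁ UA) hUA.le hU.1 hUP hapex
        (hL₁ UA ⟨le_rfl, hA1⟩) (k := 0) le_rfl (by rw [hp0, htp0]; ring) c (hcL₁ UA ⟨le_rfl, hA1⟩)

variable {UL : ℝ}

/-- **Transport-fan shadow of (E6) (half filling): the SHORT overhang at the station + the TOP of the left edge, nothing else.** Box `[p, q] × [U_A, U_max]`,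
`q ≤ 0 < U_A ≤ U_L`: the corner-objective family on `[p(2 − U_A/U_L), p] × {U_A}` and the own-word family on `{p} × [U_L, U_max]` (`−val ≤ c`) give
`ObsStiffnessSeqCeilingAt t′ U 1 c` at every box target with `t′(2U − U_A)/U ≤ p` — the whole «TransportFan» shadow of the station, with NO source left of
`p(2 − U_A/U_L)` and no inner family (the lower window degenerates to the corner `(p, U_A)`, an overhang source). [cite: KomaTasaki1994, §1] [cite: ScalapinoWhiteZhang1993, §II] -/
theorem ObsStiffnessSeqCeilingAt_halfFilling_transportShadow_of_shortOverhang_and_leftEdgeTop (hUA : 0 < UA) (hAL : UA ≤ UL) (hq : q ≤ 0)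
    (valO valL : ℝ → ℝ) (c : ℚ)
    (hO : ∀ s ∈ Set.Icc (p * (2 - UA / UL)) p,
      ∀ (ω : InfVolFermionState 2) (Ls : ℕ → ℕ) (ψ : ∀ L, Fock (Orb (FermionTorus 2 L))),
      Tendsto Ls atTop atTop →
      (∀ j, IsGroundStateInSector (hubbardTorusTT' (Ls j) 1 s UA) (rectN 1 (Ls j)) 0 (ψ (Ls j))) →
      (∀ j, star (ψ (Ls j)) ⬝ᵥ ψ (Ls j) = 1) → ω.IsTorusLimitOf ψ Ls →
      valO s ≤ ((Finset.univ : Finset (DihedralGroup 4)).card : ℝ)⁻¹ * ∑ g ∈ (Finset.univ : Finset (DihedralGroup 4)),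
        (ω.expect (d4ShiftSet g 0 (box 2 7)) (fermionEmbed (PolySite.d4Emb g 0 (box 2 7)) (-oddMomentObsTT p UA 0))).re)
    (hcO : ∀ s ∈ Set.Icc (p * (2 - UA / UL)) p, -valO s ≤ ((c : ℚ) : ℝ))
    (hL : ∀ U' ∈ Set.Icc UL Umax,
      ∀ (ω : InfVolFermionState 2) (Ls : ℕ → ℕ) (ψ : ∀ L, Fock (Orb (FermionTorus 2 L))),
      Tendsto Ls atTop atTop →
      (∀ j, IsGroundStateInSector (hubbardTorusTT' (Ls j) 1 p U') (rectN 1 (Ls j)) 0 (ψ (Ls j))) →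
      (∀ j, star (ψ (Ls j)) ⬝ᵥ ψ (Ls j) = 1) → ω.IsTorusLimitOf ψ Ls →
      valL U' ≤ ((Finset.univ : Finset (DihedralGroup 4)).card : ℝ)⁻¹ * ∑ g ∈ (Finset.univ : Finset (DihedralGroup 4)),
        (ω.expect (d4ShiftSet g 0 (box 2 7)) (fermionEmbed (PolySite.d4Emb g 0 (box 2 7)) (-oddMomentObsTT p U' 0))).re)
    (hcL : ∀ U' ∈ Set.Icc UL Umax, -valL U' ≤ ((c : ℚ) : ℝ)) :
    ∀ tp ∈ Set.Icc p q, ∀ U ∈ Set.Icc UA Umax, tp * (2 * U - UA) / U ≤ p → ObsStiffnessSeqCeilingAt tp U 1 c := by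
  have hL0 : 0 < UL := hUA.trans_le hAL
  have hr : UA / UL ≤ 1 := (div_le_one hL0).2 hAL
  intro tp htp U hU hsA
  have hp0 : p ≤ 0 := htp.1.trans (htp.2.trans hq)
  have h1 : 0 ≤ (-p) * (1 - UA / UL) := mul_nonneg (by linarith) (by linarith)
  have e1 : p * (2 - UA / UL) = p - (-p) * (1 - UA / UL) := by ring
  have hmemp : p ∈ Set.Icc (p * (2 - UA / UL)) p := ⟨by linarith [e1], le_rfl⟩
  refine ObsStiffnessSeqCeilingAt_halfFilling_transportShadow_of_twoWindowCurtain (UL₁ := UA) (UL₂ := UL) hUA le_rfl hAL hq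
    (fun _ => valO p) valO valL c (fun U' hU' => ?_) (fun U' hU' => hcO p hmemp) hO hcO hL hcL tp htp U hU hsA
  have hU'A : U' = UA := le_antisymm hU'.2 hU'.1
  subst hU'A
  exact hO p hmemp

end Shadow

/-! ## «La214-E»: the transport-fan shadow of the station `29/5` from the short overhang + the left-edge top -/

section LaBoxE

/-- **«La214-E» transport-fan shadow, any window height `U_L ≥ 29/5`**: the corner-objective family on `[(−3/10)(2 − (29/5)/U_L), −3/10] × {29/5}` and the own-word
family on `{−3/10} × [U_L, 74/5]` (`−val ≤ c`) ⇒ `ObsStiffnessSeqCeilingAt t′ U 1 c` at every target of `[−3/10, −1/5] × [29/5, 74/5]` with `t′(2U − 29/5)/U ≤ −3/10`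
(the K2 «TransportFanCeiling» region of route CovLa214M2b). [cite: KomaTasaki1994, §1] [cite: ScalapinoWhiteZhang1993, §II] -/
theorem ObsStiffnessSeqCeilingAt_on_laBoxE_transportShadow_of_shortOverhang_and_leftEdgeTop (UL : ℝ) (hAL : 29 / 5 ≤ UL)
    (valO valL : ℝ → ℝ) (c : ℚ)
    (hO : ∀ s ∈ Set.Icc (-3 / 10 * (2 - 29 / 5 / UL) : ℝ) (-3 / 10),
      ∀ (ω : InfVolFermionState 2) (Ls : ℕ → ℕ) (ψ : ∀ L, Fock (Orb (FermionTorus 2 L))),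
      Tendsto Ls atTop atTop →
      (∀ j, IsGroundStateInSector (hubbardTorusTT' (Ls j) 1 s (29 / 5)) (rectN 1 (Ls j)) 0 (ψ (Ls j))) →
      (∀ j, star (ψ (Ls j)) ⬝ᵥ ψ (Ls j) = 1) → ω.IsTorusLimitOf ψ Ls →
      valO s ≤ ((Finset.univ : Finset (DihedralGroup 4)).card : ℝ)⁻¹ * ∑ g ∈ (Finset.univ : Finset (DihedralGroup 4)),
        (ω.expect (d4ShiftSet g 0 (box 2 7)) (fermionEmbed (PolySite.d4Emb g 0 (box 2 7)) (-oddMomentObsTT (-3 / 10) (29 / 5) 0))).re)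
    (hcO : ∀ s ∈ Set.Icc (-3 / 10 * (2 - 29 / 5 / UL) : ℝ) (-3 / 10), -valO s ≤ ((c : ℚ) : ℝ))
    (hL : ∀ U' ∈ Set.Icc UL (74 / 5),
      ∀ (ω : InfVolFermionState 2) (Ls : ℕ → ℕ) (ψ : ∀ L, Fock (Orb (FermionTorus 2 L))),
      Tendsto Ls atTop atTop →
      (∀ j, IsGroundStateInSector (hubbardTorusTT' (Ls j) 1 (-3 / 10) U') (rectN 1 (Ls j)) 0 (ψ (Ls j))) →
      (∀ j, star (ψ (Ls j)) ⬝ᵥ ψ (Ls j) = 1) → ω.IsTorusLimitOf ψ Ls →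
      valL U' ≤ ((Finset.univ : Finset (DihedralGroup 4)).card : ℝ)⁻¹ * ∑ g ∈ (Finset.univ : Finset (DihedralGroup 4)),
        (ω.expect (d4ShiftSet g 0 (box 2 7)) (fermionEmbed (PolySite.d4Emb g 0 (box 2 7)) (-oddMomentObsTT (-3 / 10) U' 0))).re)
    (hcL : ∀ U' ∈ Set.Icc UL (74 / 5), -valL U' ≤ ((c : ℚ) : ℝ)) :
    ∀ tp ∈ Set.Icc (-3 / 10 : ℝ) (-1 / 5), ∀ U ∈ Set.Icc (29 / 5 : ℝ) (74 / 5),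
      tp * (2 * U - 29 / 5) / U ≤ -3 / 10 → ObsStiffnessSeqCeilingAt tp U 1 c :=
  ObsStiffnessSeqCeilingAt_halfFilling_transportShadow_of_shortOverhang_and_leftEdgeTop (by norm_num) hAL (by norm_num) valO valL c hO hcO hL hcL

/-- **«La214-E» transport-fan shadow with `U_L = 8`**: corner-objective (`−X₀(−3/10)`) words on `[−153/400, −3/10] × {29/5}` + own words on `{−3/10} × [8, 74/5]`
(`−val ≤ c`) ⇒ `ObsStiffnessSeqCeilingAt t′ U 1 c` at every target of the box with `t′(2U − 29/5)/U ≤ −3/10` — NO source left of `−153/400`, no inner family, no far vertex.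
[cite: KomaTasaki1994, §1] [cite: ScalapinoWhiteZhang1993, §II] -/
theorem ObsStiffnessSeqCeilingAt_on_laBoxE_transportShadow_of_shortOverhang153o400_and_leftEdgeTop8 (valO valL : ℝ → ℝ) (c : ℚ)
    (hO : ∀ s ∈ Set.Icc (-(153 / 400) : ℝ) (-3 / 10),
      ∀ (ω : InfVolFermionState 2) (Ls : ℕ → ℕ) (ψ : ∀ L, Fock (Orb (FermionTorus 2 L))),
      Tendsto Ls atTop atTop →
      (∀ j, IsGroundStateInSector (hubbardTorusTT' (Ls j) 1 s (29 / 5)) (rectN 1 (Ls j)) 0 (ψ (Ls j))) →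
      (∀ j, star (ψ (Ls j)) ⬝ᵥ ψ (Ls j) = 1) → ω.IsTorusLimitOf ψ Ls →
      valO s ≤ ((Finset.univ : Finset (DihedralGroup 4)).card : ℝ)⁻¹ * ∑ g ∈ (Finset.univ : Finset (DihedralGroup 4)),
        (ω.expect (d4ShiftSet g 0 (box 2 7)) (fermionEmbed (PolySite.d4Emb g 0 (box 2 7)) (-oddMomentObsTT (-3 / 10) (29 / 5) 0))).re)
    (hcO : ∀ s ∈ Set.Icc (-(153 / 400) : ℝ) (-3 / 10), -valO s ≤ ((c : ℚ) : ℝ))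
    (hL : ∀ U' ∈ Set.Icc (8 : ℝ) (74 / 5),
      ∀ (ω : InfVolFermionState 2) (Ls : ℕ → ℕ) (ψ : ∀ L, Fock (Orb (FermionTorus 2 L))),
      Tendsto Ls atTop atTop →
      (∀ j, IsGroundStateInSector (hubbardTorusTT' (Ls j) 1 (-3 / 10) U') (rectN 1 (Ls j)) 0 (ψ (Ls j))) →
      (∀ j, star (ψ (Ls j)) ⬝ᵥ ψ (Ls j) = 1) → ω.IsTorusLimitOf ψ Ls →
      valL U' ≤ ((Finset.univ : Finset (DihedralGroup 4)).card : ℝ)⁻¹ * ∑ g ∈ (Finset.univ : Finset (DihedralGroup 4)),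
        (ω.expect (d4ShiftSet g 0 (box 2 7)) (fermionEmbed (PolySite.d4Emb g 0 (box 2 7)) (-oddMomentObsTT (-3 / 10) U' 0))).re)
    (hcL : ∀ U' ∈ Set.Icc (8 : ℝ) (74 / 5), -valL U' ≤ ((c : ℚ) : ℝ)) :
    ∀ tp ∈ Set.Icc (-3 / 10 : ℝ) (-1 / 5), ∀ U ∈ Set.Icc (29 / 5 : ℝ) (74 / 5),
      tp * (2 * U - 29 / 5) / U ≤ -3 / 10 → ObsStiffnessSeqCeilingAt tp U 1 c := by
  refine ObsStiffnessSeqCeilingAt_on_laBoxE_transportShadow_of_shortOverhang_and_leftEdgeTop 8 (by norm_num) valO valL c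
    (fun s hs => ?_) (fun s hs => ?_) hL hcL
  · rw [laBoxE_leftTop8_overhang] at hs; exact hO s hs
  · rw [laBoxE_leftTop8_overhang] at hs; exact hcO s hs

end LaBoxE

end Summit.Ventures.CertifiedManyBodySolver.Observables

end
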